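import Summits.ResolutionOfSingularities.ResolutionOfSingularities.Theorems.WeightedInvariantWeightedThesisHypersurfaceStrategyTower
import HarnessLib

/-!
# Crux `WeightedThesis` (stmt-ResolutionOfSingularities-0569): the composition through a hypersurface STRATEGY

Topic: `Summits/ResolutionOfSingularities/ResolutionOfSingularities/Theorems`. Route
`ResolutionOfSingularities/WeightedInvariant`, crux `Theses.WeightedInvariant.WeightedThesis` (resolution
of every reduced separated scheme of finite type over every PERFECT field of characteristic `p`, every
prime `p`), line `datum-glued-split`, lead c8, RESHAPE 8 — the ASSEMBLY for the strategy interface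
`HypersurfaceCentreStrategy p` (`Theorems/…HypersurfaceStrategy.lean`), on top of the tower
`HypersurfaceStrategyTower.hasResolution_quotient_of_gradedAtlas` (`Theorems/…HypersurfaceStrategyTower.lean`):

* `HypersurfaceStrategyTower.hasResolution_hypersurface_of_strategy_field` — a strategy at `p = char k`
  and Bergh–Rydh over the perfect field `k` resolve every integral hypersurface of every smooth separated
  quasi-compact `k`-scheme (the tower on the trivial presentation of rank `0`);
* `HypersurfaceStrategyTower.hasResolution_of_strategy_field` — and every reduced separated `k`-scheme
  of finite type (the line's hypersurface reduction `HypersurfacesIff.hasResolution_of_hypersurfaces`);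
* `HypersurfaceStrategyTower.resolution_field_iff_berghRydh_field_of_strategy` — given a strategy at
  `p = char k`, resolution over `k` ⟺ Bergh–Rydh over `k`;
* `weightedThesis_of_hypersurfaceStrategy_of_forall_berghRydh_charP` (registered stub of the line) —
  **`(∀ p prime, Nonempty (HypersurfaceCentreStrategy p))` and the characteristic-`p` instances of
  Bergh–Rydh give `WeightedThesis`**: the RESHAPE 8 composition, from a first input with 5 obligations
  instead of RESHAPE 7's 13 (fed with `hyp_nonempty_strategy_of_hypersurfaceDatum` it is the landed RESHAPE 7
  composition `weightedThesis_of_hypersurfaceConstruction_of_forall_berghRydh_charP`).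
-/

noncomputable section

open CategoryTheory CategoryTheory.Limits AlgebraicGeometry TopologicalSpace
open Literature.AlgebraicGeometry.Resolution
open Summit.ResolutionOfSingularities.ResolutionOfSingularities.Theses.WeightedInvariant
open Summit.ResolutionOfSingularities.ResolutionOfSingularities.Theorems

set_option linter.dupNamespace false -- mandated namespace of this single-conjunct summit

namespace Summit.ResolutionOfSingularities.ResolutionOfSingularities.Theorems.HypersurfaceStrategyTower

/-! ## Strategy + Bergh–Rydh over `k` ⇒ resolution over `k` -/

/-- **A hypersurface centre strategy in characteristic `p` and Bergh–Rydh over the perfect field `k`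
of characteristic `p` resolve every integral HYPERSURFACE of every smooth separated quasi-compact
`k`-scheme** (run `hasResolution_quotient_of_gradedAtlas` on the trivial presentation `q = 𝟙 X` of rank
`0`, `DatumToEmbedded.InitialAtlas.stub_initialAtlas`). [cite: Wlodarczyk2022, Thm 1.1.6; BerghRydh2019, Thm 5] -/
theorem hasResolution_hypersurface_of_strategy_field
    {p : ℕ} (S : HypersurfaceCentreStrategy p) {k : Type} [Field k] [CharP k p] [PerfectField k]
    (hBR : ∀ (V : Scheme.{0}) (g : V ⟶ Spec (.of k)) [IsIntegral V] [IsSeparated g]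
      [LocallyOfFiniteType g] [QuasiCompact g],
      (∀ v : V, ∃ (A : Type) (_ : AddCommGroup A) (_ : Finite A) (_ : DecidableEq A)
        (S : Type) (_ : CommRing S) (_ : Algebra k S) (𝒮 : A → Submodule k S)
        (_ : GradedAlgebra 𝒮), Algebra.FiniteType k S ∧ Algebra.Smooth k S ∧
        ∃ φ : Spec (.of (𝒮 0)) ⟶ V, Etale φ ∧ v ∈ Set.range φ ∧
          φ ≫ g = Spec.map (CommRingCat.ofHom (algebraMap k (𝒮 0)))) →
      Scheme.HasResolution V)
    {Y X : Scheme.{0}} (f : Y ⟶ Spec (.of k)) [Smooth f] [IsSeparated f] [QuasiCompact f]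
    (i : X ⟶ Y) [IsClosedImmersion i] [IsIntegral X] (hX : IsLocallyPrincipal i.ker) :
    Scheme.HasResolution X := by
  obtain ⟨𝒜₀⟩ := DatumToEmbedded.InitialAtlas.stub_initialAtlas f i
  haveI : IsSeparated (i ≫ f) := inferInstance
  haveI : LocallyOfFiniteType (i ≫ f) := inferInstance
  haveI : QuasiCompact (i ≫ f) := inferInstance
  exact hasResolution_quotient_of_gradedAtlas S hBR
    (@HypersurfacePair.mk k _ Y f inferInstance inferInstance inferInstance i.ker hX
      (HypersurfaceTower.isIntegral_ker_subscheme i))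
    X X i rfl (i ≫ f) (𝟙 X) (Category.id_comp _) 0 𝒜₀

/-- **A hypersurface centre strategy in characteristic `p` and Bergh–Rydh over the perfect field `k` of
characteristic `p` resolve every reduced separated `k`-scheme of finite type**
(`hasResolution_hypersurface_of_strategy_field` spread by the hypersurface reduction
`HypersurfacesIff.hasResolution_of_hypersurfaces`: irreducible components, Chow's lemma, hypersurface
models by generic projection / graph closures, finite birational transfer).
[cite: Wlodarczyk2022, Thm 1.1.6; BerghRydh2019, Thm 5; Kollar2007, Prop. 2.48 (proof)] -/
theorem hasResolution_of_strategy_field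
    {p : ℕ} (hp : p.Prime) (S : HypersurfaceCentreStrategy p) {k : Type} [Field k] [CharP k p]
    [PerfectField k]
    (hBR : ∀ (V : Scheme.{0}) (g : V ⟶ Spec (.of k)) [IsIntegral V] [IsSeparated g]
      [LocallyOfFiniteType g] [QuasiCompact g],
      (∀ v : V, ∃ (A : Type) (_ : AddCommGroup A) (_ : Finite A) (_ : DecidableEq A)
        (S : Type) (_ : CommRing S) (_ : Algebra k S) (𝒮 : A → Submodule k S)
        (_ : GradedAlgebra 𝒮), Algebra.FiniteType k S ∧ Algebra.Smooth k S ∧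
        ∃ φ : Spec (.of (𝒮 0)) ⟶ V, Etale φ ∧ v ∈ Set.range φ ∧
          φ ≫ g = Spec.map (CommRingCat.ofHom (algebraMap k (𝒮 0)))) →
      Scheme.HasResolution V)
    (X : Scheme.{0}) (f : X ⟶ Spec (.of k)) [IsSeparated f] [LocallyOfFiniteType f]
    [QuasiCompact f] [IsReduced X] : Scheme.HasResolution X :=
  Summit.ResolutionOfSingularities.ResolutionOfSingularities.Theorems.WeightedThesis.HypersurfacesIff.hasResolution_of_hypersurfaces hp k
    (fun Y H g j hg hs hq hj hint hpr => by
      haveI := hg; haveI := hs; haveI := hq; haveI := hj; haveI := hint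
      exact hasResolution_hypersurface_of_strategy_field S hBR g j
        (isLocallyPrincipal_of_forall_isPrincipal hpr)) X f

/-- **The field-wise residue of the crux with a hypersurface centre STRATEGY.** Over a perfect field `k`
of characteristic `p` carrying a hypersurface centre strategy `S : HypersurfaceCentreStrategy p`,
resolution of every reduced separated `k`-scheme of finite type is EQUIVALENT to Bergh–Rydh's theorem
over `k` (`→` forgets the quotient charts; `←` is the tower driven by `S`).
[cite: Wlodarczyk2022, Thm 1.1.6; BerghRydh2019, Thm 5] -/
theorem resolution_field_iff_berghRydh_field_of_strategy
    {p : ℕ} (hp : p.Prime) (S : HypersurfaceCentreStrategy p) (k : Type) [Field k] [CharP k p]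
    [PerfectField k] :
    (∀ (X : Scheme.{0}) (f : X ⟶ Spec (.of k)), IsSeparated f → LocallyOfFiniteType f →
      QuasiCompact f → IsReduced X → Scheme.HasResolution X) ↔
    ∀ (V : Scheme.{0}) (g : V ⟶ Spec (.of k)) [IsIntegral V] [IsSeparated g]
      [LocallyOfFiniteType g] [QuasiCompact g],
      (∀ v : V, ∃ (A : Type) (_ : AddCommGroup A) (_ : Finite A) (_ : DecidableEq A)
        (S : Type) (_ : CommRing S) (_ : Algebra k S) (𝒮 : A → Submodule k S)
        (_ : GradedAlgebra 𝒮), Algebra.FiniteType k S ∧ Algebra.Smooth k S ∧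
        ∃ φ : Spec (.of (𝒮 0)) ⟶ V, Etale φ ∧ v ∈ Set.range φ ∧
          φ ≫ g = Spec.map (CommRingCat.ofHom (algebraMap k (𝒮 0)))) →
      Scheme.HasResolution V :=
  ⟨Summit.ResolutionOfSingularities.ResolutionOfSingularities.Theorems.WeightedThesis.BerghRydhCharP.berghRydh_field_of_resolution_field,
    fun hBR X f hs hl hq hr => by
    haveI := hs; haveI := hl; haveI := hq; haveI := hr
    exact hasResolution_of_strategy_field hp S hBR X f⟩

end Summit.ResolutionOfSingularities.ResolutionOfSingularities.Theorems.HypersurfaceStrategyTower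

namespace Summit.ResolutionOfSingularities.ResolutionOfSingularities.Theorems

/-! ## The crux from a hypersurface STRATEGY and prime-wise Bergh–Rydh -/

/-- **`WeightedThesis` from a hypersurface centre STRATEGY and the characteristic-`p` instances of
Bergh–Rydh** (registered stub of line `datum-glued-split`, RESHAPE 8, crux stmt-0569): if for every
prime `p` a hypersurface centre strategy exists (`Nonempty (HypersurfaceCentreStrategy p)` — five
obligations: a centre rule which on singular integral hypersurface pairs over perfect fields of
characteristic `p` is a regular weighted centre, misses the generic point, is functorial for smooth
surjections, and whose cobordant towers stop; implied by RESHAPE 7's hypersurface construction through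
`hyp_nonempty_strategy_of_hypersurfaceDatum`, hence by `WeightedConstruction`), and for every prime `p`
and every perfect field `k` of characteristic `p` every integral separated finite-type `k`-scheme with
finite diagonalizable quotient singularities étale-locally has a resolution, then every reduced separated
scheme of finite type over every perfect field of positive characteristic has a resolution.
[cite: Wlodarczyk2022, Thm 1.1.6; BerghRydh2019, Thm 5; AbramovichTemkinWlodarczyk2024, §1.9] -/
theorem weightedThesis_of_hypersurfaceStrategy_of_forall_berghRydh_charP : (∀ p : ℕ, p.Prime → Nonempty (Summit.ResolutionOfSingularities.ResolutionOfSingularities.Theorems.HypersurfaceCentreStrategy p)) → (∀ p : ℕ, p.Prime → ∀ (k : Type) [Field k] [CharP k p] [PerfectField k] (V : AlgebraicGeometry.Scheme.{0}) (g : V ⟶ AlgebraicGeometry.Spec (.of k)) [AlgebraicGeometry.IsIntegral V] [AlgebraicGeometry.IsSeparated g] [AlgebraicGeometry.LocallyOfFiniteType g] [AlgebraicGeometry.QuasiCompact g], (∀ v : V, ∃ (A : Type) (_ : AddCommGroup A) (_ : Finite A) (_ : DecidableEq A) (S : Type) (_ : CommRing S) (_ : Algebra k S) (𝒮 : A → Submodule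 k S) (_ : GradedAlgebra 𝒮), Algebra.FiniteType k S ∧ Algebra.Smooth k S ∧ ∃ φ : AlgebraicGeometry.Spec (.of (𝒮 0)) ⟶ V, AlgebraicGeometry.Etale φ ∧ v ∈ Set.range φ ∧ φ ≫ g = AlgebraicGeometry.Spec.map (CommRingCat.ofHom (algebraMap k (𝒮 0)))) → Literature.AlgebraicGeometry.Resolution.Scheme.HasResolution V) → Summit.ResolutionOfSingularities.ResolutionOfSingularities.Theses.WeightedInvariant.WeightedThesis := by
  intro hS hBR p hp k _ _ _ X f hs hl hq hr
  obtain ⟨S⟩ := hS p hp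
  haveI := hs; haveI := hl; haveI := hq; haveI := hr
  exact HypersurfaceStrategyTower.hasResolution_of_strategy_field hp S
    (fun V g _ _ _ _ hV => hBR p hp k V g hV) X f

end Summit.ResolutionOfSingularities.ResolutionOfSingularities.Theorems

end
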